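import Summits.BirchSwinnertonDyer.Rank1Residual.Supersingular.KuriharaTwistRecordLevelKPrimeLevel
import HarnessLib

/-!
# Depth-`k` Kurihara number `≠ 0` at a TWO-PRIME level `n = ℓ₁·ℓ₂`, read off the literal integer equation: the `hδ` binder of the
# `𝒩_k`-PAIR consumers (N6 TAM-DEFECT record `bsdp_x8r0kim9_9950f1_n2674657`, x10b's N4 two-prime certificates) from a LANDED
# `CertifiedK` row + `validHasseK` rounding certificate + the engine's `L`-value enclosure — record shape (class-free)

Cell `b2b-bsdres`, supersingular family, prover B = unit `b2b-bsdres-additive-p3` (gen 25; X7 joint pair B side; class lead N6·O3): the `ν = 2`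
companion of prover A's `kuriharaNumber_primeLevel_ne_zero_of_ainvs_of_certifiedK_of_LValueBall` (`KuriharaTwistRecordLevelKPrimeLevel.lean`,
x10b gen 13), SAME proof with two Kolyvagin primes (`Kato.IsKolyvaginProduct.mul`).  Topic file; namespace
`Summit.BirchSwinnertonDyer.Rank1Residual.Supersingular`.  ONE THEOREM (composition of tree theorems by name); no named fact, no definition,
nothing asserted about any curve, nothing booked.

HONEST FRAMING (run/shared/lean/b2b/bsd-rank1-residual/, verbatim in every file): the goal of the
cell is to DELETE the COMBINATION-SHAPED residual classes of the Birch–Swinnerton-Dyer formula for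
ALL analytic-rank `≤ 1` elliptic curves over `ℚ` — "full BSD formula for every rank `≤ 1` curve in
class `C`" assembled STRICTLY from published theorems — so that the rank-`≤ 1` remainder becomes
exactly the CONSTRUCTION-SHAPED classes, which are TYPED (missing-input `Prop`s), NOT attempted.
This is not "finishing BSD".

`kuriharaNumber_pairLevel_ne_zero_of_ainvs_of_certifiedK_of_LValueBall`: for the literal curve `[a₁,…,a₆]` (minimality as a hypothesis), a
landed depth-`k` record `r` (`CertifiedK`, TWO primes, `r.n = ℓ₁·ℓ₂`, `ℓ₁ ≠ ℓ₂`), a `RoundingCertifiedHasseK r.k` row `c` matching it, the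
decidable side conditions (`r.p ∤ Δ` and the point count at `r.p` for good reduction; for each `ℓ_i`: `ℓ_i ∤ Δ`, `ℓ_i ≡ 1 (mod p^k)`,
`countPoints … ℓ_i = n_i` with `p^k ∣ n_i`, i.e. `ℓ_i ∈ 𝒫_k`; `A = (a_{ℓ₁} − 2)(a_{ℓ₂} − 2)`), surjectivity of `ρ̄_{E,p}`, `ψ` surjective at both
primes, and the ENCLOSURE `hballL` of `D'·c_∞·re(A·L(E,1) + Σ_{j≠0} e_q(−jk)·τ(χ_j)·L_j(1))/(q·Ω⁺_f)` for the `q = p^k` bins ⟹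
`kuriharaNumber D.f (p^k) (ℓ₁ℓ₂) ψ ≠ 0` (`CertifiedK.kuriharaNumber_ne_zero_of_LValueBall`, x10b gen 13, any `ν`).

References: [Kim2022StructureSelmer] §1.2.2, §1.4.3; [MazurTateTeitelbaum1986Invent] §I.8; [CremonaAlgorithms1997] §2.8; [SilvermanAEC2009] VII.5;
[IrelandRosen1990] Prop. 5.1.2.
-/

set_option autoImplicit false

noncomputable section

open scoped Classical MatrixGroups ModularForm

open CongruenceSubgroup WeierstrassCurve Literature.NumberTheory.EllipticCurves
  Literature.NumberTheory.EllipticCurves.ModularForms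
  Literature.NumberTheory.EllipticCurves.Rank1Residual
  Literature.NumberTheory.EllipticCurves.Rank1Residual.Typed
  Literature.NumberTheory.EllipticCurves.Rank1Residual.X11RankOneCertificates
  Summit.BirchSwinnertonDyer.BirchSwinnertonDyer.Rank1Residual.IntModel
  Summit.BirchSwinnertonDyer.BirchSwinnertonDyer.Rank1Residual.X11RankOne
  Summit.BirchSwinnertonDyer.Rank1Residual.X11b
  Summit.BirchSwinnertonDyer.Rank1Residual.Additive
  Summit.BirchSwinnertonDyer.Rank1Residual.Supersingular.KuriharaTwist

namespace Summit.BirchSwinnertonDyer.Rank1Residual.Supersingular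

/-- **Depth-`k` `δ̃_n ≠ 0` AT A TWO-PRIME LEVEL `n = ℓ₁ℓ₂` FROM THE LITERAL EQUATION, a landed `CertifiedK` row, its `validHasseK` certificate and
the `L`-value enclosure** (class-free record shape; the `ν = 2` companion of prover A's prime-level theorem; see the module docstring for the
hypothesis list).  Per pair; nothing booked.
[cite: Kim2022StructureSelmer, §1.2.2 (PDF p. 5) and §1.4.3 (PDF p. 7)] [cite: MazurTateTeitelbaum1986Invent, §I.8 (8.6)]
[cite: CremonaAlgorithms1997, §2.8 (2.8.8) (PDF p. 26)] [cite: SilvermanAEC2009, VII.1 Remark 1.1 and VII.5 Prop. 5.1(a)]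
[cite: IrelandRosen1990, Prop. 5.1.2 and §8.1] -/
theorem kuriharaNumber_pairLevel_ne_zero_of_ainvs_of_certifiedK_of_LValueBall
    (a1 a2 a3 a4 a6 : ℤ) (hmin : (⟨a1, a2, a3, a4, a6⟩ : WeierstrassCurve ℚ).IsGloballyMinimal)
    {rs : List TwistRecordK} (hrs : CertifiedK rs) {r : TwistRecordK} (hr : r ∈ rs) [Fact r.p.Prime]
    (hν : r.primes.length = 2) (hp2 : r.p ≠ 2)
    {cs : List RoundingCert} (hcs : RoundingCertifiedHasseK r.k cs) {c : RoundingCert} (hcc : c ∈ cs)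
    (hcp : c.p = r.p) (hcn : c.n = r.n) (hcden : c.den = r.den) (hcbins : c.bins = r.bins) (hD' : 0 < c.dstar)
    -- good reduction at `r.p`
    (hpΔ : ¬ (r.p : ℤ) ∣ discOf [a1, a2, a3, a4, a6]) {np : ℕ} (hcnt : countPoints [a1, a2, a3, a4, a6] r.p = np)
    (hap : (r.p : ℤ) ∣ (r.p : ℤ) + 1 - np)
    (hsurj : (⟨a1, a2, a3, a4, a6⟩ : WeierstrassCurve ℚ).HasSurjectiveModNGaloisRep r.p)
    -- the level `r.n = ℓ₁·ℓ₂`, `ℓ₁ ≠ ℓ₂ ∈ 𝒫_k`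
    (ℓ₁ ℓ₂ : ℕ) [Fact ℓ₁.Prime] [Fact ℓ₂.Prime] [NeZero r.n] (hrn : ℓ₁ * ℓ₂ = r.n) (h12 : ℓ₁ ≠ ℓ₂)
    (hℓp₁ : ℓ₁ ≠ r.p) (hℓ2₁ : ℓ₁ ≠ 2) (hℓΔ₁ : ¬ (ℓ₁ : ℤ) ∣ discOf [a1, a2, a3, a4, a6]) (h1₁ : ℓ₁ ≡ 1 [MOD r.p ^ r.k])
    {n₁ : ℕ} (hc₁ : countPoints [a1, a2, a3, a4, a6] ℓ₁ = n₁) (hd₁ : r.p ^ r.k ∣ n₁)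
    (hℓp₂ : ℓ₂ ≠ r.p) (hℓ2₂ : ℓ₂ ≠ 2) (hℓΔ₂ : ¬ (ℓ₂ : ℤ) ∣ discOf [a1, a2, a3, a4, a6]) (h1₂ : ℓ₂ ≡ 1 [MOD r.p ^ r.k])
    {n₂ : ℕ} (hc₂ : countPoints [a1, a2, a3, a4, a6] ℓ₂ = n₂) (hd₂ : r.p ^ r.k ∣ n₂)
    {A : ℤ} (hA : A = ((ℓ₁ : ℤ) + 1 - n₁ - 2) * ((ℓ₂ : ℤ) + 1 - n₂ - 2))
    {N : ℕ} [NeZero N] (D : ModularParametrizationData (⟨a1, a2, a3, a4, a6⟩ : WeierstrassCurve ℚ) N)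
    (ψ : (ℓ' : ℕ) → (ZMod ℓ')ˣ →* Multiplicative (ZMod (r.p ^ r.k)))
    (hψ₁ : Function.Surjective (ψ ℓ₁)) (hψ₂ : Function.Surjective (ψ ℓ₂))
    (hballL : ∀ (L : ZMod (r.p ^ r.k) → ℂ → ℂ), (∀ j, j ≠ 0 → Differentiable ℂ (L j)) →
      (∀ j, j ≠ 0 → ∀ s : ℂ, 2 < s.re → L j s = twistedLSeries D.f (binChar r.n ψ j)⁻¹ s) →
      ∀ k < r.p ^ r.k, ∃ mid rad : ℝ, rad ≤ (c.radNum : ℝ) / 10 ^ c.radExp ∧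
        |mid - ((c.binsStar.getD k 0 : ℤ) : ℝ)| ≤ (c.marNum : ℝ) / 10 ^ c.marExp ∧
        |(c.dstar : ℝ) * ((r.components : ℝ) *
          (((A : ℂ) * (⟨a1, a2, a3, a4, a6⟩ : WeierstrassCurve ℚ).entireLFunction 1 +
            ∑ j ∈ (Finset.univ : Finset (ZMod (r.p ^ r.k))).erase 0,
              ZMod.stdAddChar (-(j * (k : ZMod (r.p ^ r.k)))) *
                (gaussSum (binChar r.n ψ j) (ZMod.stdAddChar (N := r.n)) * L j 1)).re /
            ((r.p ^ r.k : ℕ) * plusPeriod D.f))) - mid| ≤ rad) :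
    kuriharaNumber D.f (r.p ^ r.k) r.n ψ ≠ 0 := by
  have h0 : discOf [a1, a2, a3, a4, a6] ≠ 0 := fun h ↦ hpΔ (by rw [h]; exact dvd_zero _)
  haveI := isElliptic_of_discOf_ne_zero a1 a2 a3 a4 a6 h0
  haveI := hmin
  have hI : integralModelInt (⟨a1, a2, a3, a4, a6⟩ : WeierstrassCurve ℚ) = ⟨a1, a2, a3, a4, a6⟩ :=
    integralModelInt_eq_of_map_eq _ (map_mk_int a1 a2 a3 a4 a6)
  have hNp := natCard_point_eq_of_countPoints a1 a2 a3 a4 a6 r.p hp2 hpΔ hcnt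
  have hN₁ := natCard_point_eq_of_countPoints a1 a2 a3 a4 a6 ℓ₁ hℓ2₁ hℓΔ₁ hc₁
  have hN₂ := natCard_point_eq_of_countPoints a1 a2 a3 a4 a6 ℓ₂ hℓ2₂ hℓΔ₂ hc₂
  have hirr : (⟨a1, a2, a3, a4, a6⟩ : WeierstrassCurve ℚ).HasIrreducibleModPGaloisRep r.p :=
    hasIrreducibleModPGaloisRep_of_hasSurjectiveModNGaloisRep _ r.p hsurj
  have hgood : (⟨a1, a2, a3, a4, a6⟩ : WeierstrassCurve ℚ).HasGoodReductionAtPrime r.p :=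
    (goodSS_of_intModel r.p hI (by rw [intCurve_Δ]; exact hpΔ) hNp hap).1
  have hK₁ : Kato.IsKolyvaginPrime (⟨a1, a2, a3, a4, a6⟩ : WeierstrassCurve ℚ) r.p r.k ℓ₁ :=
    Additive.isKolyvaginPrime_of_intModel_of_card hI r.p r.k ℓ₁ hℓp₁ (by rw [intCurve_Δ]; exact hℓΔ₁) h1₁ hN₁ hd₁
  have hK₂ : Kato.IsKolyvaginPrime (⟨a1, a2, a3, a4, a6⟩ : WeierstrassCurve ℚ) r.p r.k ℓ₂ :=
    Additive.isKolyvaginPrime_of_intModel_of_card hI r.p r.k ℓ₂ hℓp₂ (by rw [intCurve_Δ]; exact hℓΔ₂) h1₂ hN₂ hd₂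
  have hcop : ℓ₁.Coprime ℓ₂ := (Nat.coprime_primes Fact.out Fact.out).mpr h12
  have hn : Kato.IsKolyvaginProduct (⟨a1, a2, a3, a4, a6⟩ : WeierstrassCurve ℚ) r.p r.k r.n := by
    rw [← hrn]; exact hK₁.isKolyvaginProduct.mul hK₂.isKolyvaginProduct hcop
  have hpf : r.n.primeFactors = {ℓ₁, ℓ₂} := by
    rw [← hrn, Nat.primeFactors_mul (Fact.out : ℓ₁.Prime).ne_zero (Fact.out : ℓ₂.Prime).ne_zero,
      (Fact.out : ℓ₁.Prime).primeFactors, (Fact.out : ℓ₂.Prime).primeFactors, ← Finset.insert_eq]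
  have hν' : r.n.primeFactors.card = r.primes.length := by
    rw [hpf, Finset.card_pair h12, hν]
  have hψ' : ∀ ℓ' ∈ r.n.primeFactors, Function.Surjective (ψ ℓ') := by
    intro ℓ' h'
    rw [hpf, Finset.mem_insert, Finset.mem_singleton] at h'
    rcases h' with rfl | rfl
    exacts [hψ₁, hψ₂]
  have hprod : (∏ ℓ' ∈ r.n.primeFactors,
      (((⟨a1, a2, a3, a4, a6⟩ : WeierstrassCurve ℚ).frobeniusTrace ℓ' : ℂ) - 2)) = (A : ℂ) := by
    rw [hpf, Finset.prod_pair h12, frobeniusTrace_eq hI hN₁, frobeniusTrace_eq hI hN₂, hA]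
    push_cast
    ring
  refine CertifiedK.kuriharaNumber_ne_zero_of_LValueBall hrs hr hν' D.isNewformOf hp2 hirr hgood hn hcs hcc hcp hcn
    hcden hcbins hD' ψ hψ' ?_
  intro L hL hL' k hk
  obtain ⟨mid, rad, h1', h2', h3'⟩ := hballL L hL hL' k hk
  refine ⟨mid, rad, h1', h2', ?_⟩
  rw [hprod]
  exact h3'

end Summit.BirchSwinnertonDyer.Rank1Residual.Supersingular

end
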